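import Summits.HubbardSuperconductivity.HubbardSuperconductivity.Theorems.SoloBlindDimerStrongCoupling
import HarnessLib

/-!
# The strong-coupling crutch threshold down to the Mott-floor limit `g (1 - δ) > 8`
# (solo-blind programme, Theorem 34″)

Theorem 34 (`SoloBlindDimerStrongCoupling`, `strongCoupling_crutch_hasLongRangeOrder`) certifies
d-wave pair-field long-range order for EVERY sector ground state of the crutched Hubbard
Hamiltonian `K_{U,g} = H_U - (g/L²) Δ_dᴴ Δ_d` on `{g ≥ 48, U ≥ 64/δ}` by testing the zero-energy
Gutzwiller dimer condensate `Ψ_n` (`n = ⌊(1-δ)L²/2⌋` dimers: no kinetic energy, no double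
occupancy, pair order `re ⟨Ψ_n, Δ_dᴴΔ_d Ψ_n⟩ ≥ 2 n (L²/2 - n + 1) ‖Ψ_n‖²`) against the Mott floor
`min_{(2n, S_z = 0)} H_U ≥ -4 (L² - 2n) - 64 L²/U` (`SoloBlindMottFloor`, `U ≥ 16`).  Its constant
`48` came from the crude bounds `n ≥ 3L²/16` and `64 L²/U ≤ δ L²`.

This file runs the SAME two inputs with exact bookkeeping.  The crutch gain of the condensate is
`(g/L²) · 2n(L²/2 - n + 1) ≥ g δ n ≥ (g δ (1-δ)/2) L² - g δ`, the hole term of the floor is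
`4 (L² - 2n) ≤ 4 δ L² + 8`, so the competition is decided by the sign of
`g δ (1-δ)/2 - 4 δ = δ (g (1-δ) - 8)/2`:

**Theorem 34″ (`mottLimit_crutch_hasLongRangeOrder`).** For `δ ∈ (0, 1/2)` and every crutch
strength `g` with `g (1 - δ) > 8`, put `ε = δ (g (1-δ) - 8) > 0`.  For every
`U ≥ 16 + 512/ε`, EVERY normalised ground-state family of `K_{U,g}` in the doped sectors
`(2⌊(1-δ)L²/2⌋, S_z = 0)` of the even tori has d-wave pair-field long-range order, with order
density `κ = ε/8` in Theorem 24(c) (`CrutchAxis.crutch_hasLongRangeOrder_of_trials`; even sides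
with `L² ≥ 4 (g δ + 8)/ε`).  The finite-volume inequality is `mottLimit_trial`.

So at strong coupling the proved-order region of the `(U, g)` plane reaches down to the curve
`g = 8/(1-δ) ∈ (8, 16)` (Theorem 34: `g = 48`; Theorem 33′: `g = 8/δ > 16`), at the price
`U ≳ 1/(δ (g(1-δ) - 8))` instead of `U ≥ 64/δ`.  This is the END of the floor method: by the
Nagaoka ceiling (Theorem 35′, `SoloBlindNagaokaCeiling`) no floor-versus-condensate argument with
this condensate reaches below `g₁(δ) = (16/π²) sin²(π√(δ/2)) / (δ(1-δ)) = (8/(1-δ)) · (sin x / x)²`,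
`x = π √(δ/2)`, because below `g₁` a zero-order eigenvalue lies under the condensate; the ratio of
the proved threshold `8/(1-δ)` to the ceiling `g₁(δ)` is `(x / sin x)² ∈ (1, π²/4)` on
`δ ∈ (0, 1/2)` (`≈ 1.18` at `δ = 0.1`) and tends to `1` as `δ → 0`.  The residual factor is
exactly the flat-bottom estimate `-4` per hole of the Mott floor against the true hole-pocket
dispersion.

Honest label: as for Theorem 34, the repulsion is used only as a Mott suppression of the
competitors' kinetic energy; the attraction is the explicit crutch and obstruction W3 (the corner
`g = 0⁺` at fixed `U`) is untouched.  The `δ → 0` blow-up of the `U`-threshold is intrinsic to a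
trial state with zero kinetic (hence zero superexchange) energy.  Elementary; no sorry.
[this work]
-/

noncomputable section

namespace Summit.HubbardSuperconductivity.HubbardSuperconductivity.Theorems.DimerMottLimit

open Matrix Finset Literature.Probability.LatticeModels Literature.MathematicalPhysics.QuantumLattice
  Literature.MathematicalPhysics.QuantumLattice.EigenvalueContinuation
open scoped ComplexOrder ComplexConjugate

variable {L : ℕ} [NeZero L]

/-- The `(j+1)`-dimer condensate of Theorem 33, packaged existentially with the four properties
used below: it lies in the sector `(2(j+1), S_z = 0)`, it is non-zero (`j + 1 ≤ #slots`), its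
d-wave pair order is at least `2 (j+1) (#slots - j) ‖Ψ‖²`, and its Hubbard energy is exactly `0`
for every `U`. [this work] -/
private theorem exists_zeroEnergy_ordered_trial (hL3 : 3 ≤ L) (hL : Even L) (U : ℝ) {j : ℕ}
    (hj : j + 1 ≤ (DimerCondensate.dimerSlots L).card) :
    ∃ Ψ : Fock (Orb (FermionTorus 2 L)),
      Ψ ∈ szSector (Λ := FermionTorus 2 L) (2 * (j + 1)) 0 ∧ Ψ ≠ 0 ∧
      2 * ((j + 1 : ℕ) : ℝ) * ((((DimerCondensate.dimerSlots L).card - j : ℕ)) : ℝ) *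
          (star Ψ ⬝ᵥ Ψ).re ≤
        (star Ψ ⬝ᵥ ((pairField dWaveFormFactor L)ᴴ * pairField dWaveFormFactor L) *ᵥ Ψ).re ∧
      (star Ψ ⬝ᵥ (hubbardTorus 2 L 1 U *ᵥ Ψ)).re = 0 :=
  ⟨_, DimerCondensate.condensate_mem_szSector (j + 1), DimerCondensate.condensate_ne_zero hj,
    DimerCondensate.condensate_order_ge hL3 hL j,
    DimerCondensate.re_expect_hubbardTorus_condensate_eq_zero hL U (j + 1)⟩

/-- **The dimer condensate against the Mott floor, exact bookkeeping** (even side `L ≥ 4` with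
`L² ≥ 4(gδ + 8)/ε`, `δ ∈ (0, 1/2)`, `g (1-δ) > 8`, `ε = δ (g(1-δ) - 8)`, `U ≥ 16 + 512/ε`): with
`n = ⌊(1-δ)L²/2⌋` there is a non-zero `Ψ` in the sector `(2n, S_z = 0)` with
`re ⟨Ψ, (H_U - (g/L²) Δ_dᴴΔ_d) Ψ⟩ ≤ (minEnergyOn (H_U) (2n, 0) - (ε/8) L²) ‖Ψ‖²`. [this work] -/
theorem mottLimit_trial (hL4 : 4 ≤ L) (hL : Even L) {δ : ℝ}
    (hδ : δ ∈ Set.Ioo (0 : ℝ) (1 / 2)) {g : ℝ} (hg : 8 < g * (1 - δ)) {U : ℝ}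
    (hU : 16 + 512 / (δ * (g * (1 - δ) - 8)) ≤ U)
    (hLg : 4 * (g * δ + 8) / (δ * (g * (1 - δ) - 8)) ≤ (L : ℝ) ^ 2) :
    ∃ Ψ : Fock (Orb (FermionTorus 2 L)),
      Ψ ∈ szSector (Λ := FermionTorus 2 L) (2 * ⌊(1 - δ) * (L : ℝ) ^ 2 / 2⌋₊) 0 ∧ Ψ ≠ 0 ∧
      (star Ψ ⬝ᵥ (hubbardTorus 2 L 1 U + ((-(g / (L : ℝ) ^ 2) : ℝ) : ℂ) •
          ((pairField dWaveFormFactor L)ᴴ * pairField dWaveFormFactor L)) *ᵥ Ψ).re ≤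
        ((hubbardTorus 2 L 1 U).minEnergyOn
            (szSector (Λ := FermionTorus 2 L) (2 * ⌊(1 - δ) * (L : ℝ) ^ 2 / 2⌋₊) 0)
          - δ * (g * (1 - δ) - 8) / 8 * (L : ℝ) ^ 2) * (star Ψ ⬝ᵥ Ψ).re := by
  obtain ⟨hδ0, hδ1⟩ := hδ
  have hgd : 0 < g * (1 - δ) - 8 := by linarith
  have hε0 : 0 < δ * (g * (1 - δ) - 8) := mul_pos hδ0 hgd
  have hL3 : 3 ≤ L := le_trans (by norm_num) hL4
  have hLr : (4 : ℝ) ≤ (L : ℝ) := by exact_mod_cast hL4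
  have hLsq : (16 : ℝ) ≤ (L : ℝ) ^ 2 := by nlinarith
  have hg0 : 0 < g := by nlinarith
  have h512 : 0 < 512 / (δ * (g * (1 - δ) - 8)) := by positivity
  have hU16 : 16 ≤ U := by linarith
  have hU0 : 0 < U := by linarith
  have hUε : 512 ≤ U * (δ * (g * (1 - δ) - 8)) := by
    have h1 : 512 / (δ * (g * (1 - δ) - 8)) ≤ U := by linarith
    exact (div_le_iff₀ hε0).1 h1
  -- the superexchange term of the floor: `64 L²/U ≤ (ε/8) L²`
  have h64 : 64 * (L : ℝ) ^ 2 / U ≤ δ * (g * (1 - δ) - 8) / 8 * (L : ℝ) ^ 2 := by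
    rw [div_le_iff₀ hU0]
    have h1 : 64 * (L : ℝ) ^ 2 ≤ (U * (δ * (g * (1 - δ) - 8)) / 8) * (L : ℝ) ^ 2 :=
      mul_le_mul_of_nonneg_right (by linarith) (by positivity)
    have h2 : (U * (δ * (g * (1 - δ) - 8)) / 8) * (L : ℝ) ^ 2 =
        δ * (g * (1 - δ) - 8) / 8 * (L : ℝ) ^ 2 * U := by ring
    linarith
  -- the size condition: `4 (gδ + 8) ≤ ε L²`
  have hLg' : 4 * (g * δ + 8) ≤ δ * (g * (1 - δ) - 8) * (L : ℝ) ^ 2 :=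
    (div_le_iff₀' hε0).1 (by simpa [mul_comm] using hLg)
  have harg : 0 ≤ (1 - δ) * (L : ℝ) ^ 2 / 2 := by nlinarith
  -- `n = ⌊(1-δ)L²/2⌋ = j + 1`
  have hn1 : 1 ≤ ⌊(1 - δ) * (L : ℝ) ^ 2 / 2⌋₊ := by
    rw [Nat.one_le_floor_iff]
    nlinarith
  obtain ⟨j, hj⟩ : ∃ j, ⌊(1 - δ) * (L : ℝ) ^ 2 / 2⌋₊ = j + 1 :=
    ⟨_, (Nat.sub_add_cancel hn1).symm⟩
  have hn_le : ((j + 1 : ℕ) : ℝ) ≤ (1 - δ) * (L : ℝ) ^ 2 / 2 := by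
    rw [← hj]; exact Nat.floor_le harg
  have hn_ge : (1 - δ) * (L : ℝ) ^ 2 / 2 - 1 ≤ ((j + 1 : ℕ) : ℝ) := by
    rw [← hj]; linarith [Nat.lt_floor_add_one ((1 - δ) * (L : ℝ) ^ 2 / 2)]
  rw [hj]
  -- `m = #slots = L²/2`
  set m := (DimerCondensate.dimerSlots L).card with hm
  have h2m : 2 * (m : ℝ) = (L : ℝ) ^ 2 := by
    exact_mod_cast DimerCondensate.two_mul_card_dimerSlots hL
  have hjm : ((j + 1 : ℕ) : ℝ) ≤ (m : ℝ) := by nlinarith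
  have hjm' : j + 1 ≤ m := by exact_mod_cast hjm
  have hmj : ((m - j : ℕ) : ℝ) = (m : ℝ) - j := by
    rw [Nat.cast_sub (by omega)]
  -- the trial state (never spelled out: collected from Theorem 33's lemmas)
  obtain ⟨Ψ, hΨK, hne, hO, hH⟩ := exists_zeroEnergy_ordered_trial hL3 hL U hjm'
  have hK : szSector (Λ := FermionTorus 2 L) (2 * (j + 1)) 0 ≠ ⊥ :=
    (Submodule.ne_bot_iff _).2 ⟨Ψ, hΨK, hne⟩
  refine ⟨Ψ, hΨK, hne, ?_⟩
  rw [DimerCondensate.re_rayleigh_add_real_smul]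
  set P := (star Ψ ⬝ᵥ Ψ).re with hP
  have hP0 : 0 ≤ P := (re_star_dotProduct_self_pos hne).le
  have hmin := MottFloor.mott_floor_minEnergyOn (L := L) hU16 (N := 2 * (j + 1)) (M := 0) hK
  rw [hmj] at hO
  -- abbreviations
  set n' : ℝ := ((j + 1 : ℕ) : ℝ) with hn'
  set E := (hubbardTorus 2 L 1 U).minEnergyOn (szSector (Λ := FermionTorus 2 L) (2 * (j + 1)) 0)
    with hE
  set RO := (star Ψ ⬝ᵥ
    ((pairField dWaveFormFactor L)ᴴ * pairField dWaveFormFactor L) *ᵥ Ψ).re with hRO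
  have hN : (((2 * (j + 1) : ℕ)) : ℝ) = 2 * n' := by rw [hn']; push_cast; ring
  rw [hN] at hmin
  have hjr : (j : ℝ) = n' - 1 := by
    rw [hn']; push_cast; ring
  -- `m - j ≥ δ L² / 2`, `n' ≥ (1-δ) L²/2 - 1`
  have hmj_ge : δ * (L : ℝ) ^ 2 / 2 ≤ (m : ℝ) - j := by rw [hjr]; linarith
  -- the hole term of the Mott floor: `4 (L² - 2n') ≤ 4 δ L² + 8`
  have hholes : 4 * ((L : ℝ) ^ 2 - 2 * n') ≤ 4 * δ * (L : ℝ) ^ 2 + 8 := by linarith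
  -- the pairing gain: `(g/L²) · 2 n' (m - j) ≥ g δ n' ≥ (g δ (1-δ)/2) L² - g δ`
  have e1 : g / (L : ℝ) ^ 2 * (2 * n' * (δ * (L : ℝ) ^ 2 / 2)) = g * δ * n' := by
    field_simp
  have e2 : g / (L : ℝ) ^ 2 * (2 * n' * (δ * (L : ℝ) ^ 2 / 2)) ≤
      g / (L : ℝ) ^ 2 * (2 * n' * ((m : ℝ) - j)) :=
    mul_le_mul_of_nonneg_left (mul_le_mul_of_nonneg_left hmj_ge (by positivity)) (by positivity)
  have q1 : g * δ * ((1 - δ) * (L : ℝ) ^ 2 / 2 - 1) ≤ g * δ * n' :=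
    mul_le_mul_of_nonneg_left hn_ge (by positivity)
  have q2 : g * δ * ((1 - δ) * (L : ℝ) ^ 2 / 2 - 1) =
      4 * δ * (L : ℝ) ^ 2 + δ * (g * (1 - δ) - 8) / 2 * (L : ℝ) ^ 2 - g * δ := by ring
  have key : 4 * ((L : ℝ) ^ 2 - 2 * n') + 64 * (L : ℝ) ^ 2 / U
        + δ * (g * (1 - δ) - 8) / 8 * (L : ℝ) ^ 2 ≤
      g / (L : ℝ) ^ 2 * (2 * n' * ((m : ℝ) - j)) := by
    linarith [e1, e2, q1, q2, hholes, h64, hLg']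
  -- assemble
  have stepa : -(g / (L : ℝ) ^ 2) * RO ≤ -(g / (L : ℝ) ^ 2) * (2 * n' * ((m : ℝ) - j) * P) :=
    mul_le_mul_of_nonpos_left hO (by rw [neg_nonpos]; positivity)
  have stepb : (-(g / (L : ℝ) ^ 2 * (2 * n' * ((m : ℝ) - j)))) * P ≤
      (E - δ * (g * (1 - δ) - 8) / 8 * (L : ℝ) ^ 2) * P :=
    mul_le_mul_of_nonneg_right (by linarith) hP0
  linarith [hH, stepa, stepb]

/-- **Theorem 34″ (the strong-coupling crutch threshold down to the Mott-floor limit).** For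
`δ ∈ (0, 1/2)`, every `g` with `g (1 - δ) > 8` and every `U ≥ 16 + 512/(δ(g(1-δ) - 8))`, EVERY
normalised ground-state family of the crutched Hubbard Hamiltonians `H_U - (g/L²) Δ_dᴴ Δ_d` in the
doped sectors `(2⌊(1-δ)L²/2⌋, S_z = 0)` of the even tori has d-wave pair-field long-range order
(order density `δ(g(1-δ) - 8)/8`; Theorem 34 had `g ≥ 48`, `U ≥ 64/δ`).  The threshold curve
`g = 8/(1-δ)` lies within the factor `(x/sin x)², x = π√(δ/2)`, of the ceiling `g₁(δ)` of the floor
method (Theorem 35′). [this work] -/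
theorem mottLimit_crutch_hasLongRangeOrder {δ : ℝ} (hδ : δ ∈ Set.Ioo (0 : ℝ) (1 / 2))
    {g : ℝ} (hg : 8 < g * (1 - δ)) {U : ℝ} (hU : 16 + 512 / (δ * (g * (1 - δ) - 8)) ≤ U)
    (ψ : ∀ L, Fock (Orb (FermionTorus 2 L)))
    (hψ : ∀ m : ℕ, Even (m + 1) → star (ψ (m + 1)) ⬝ᵥ ψ (m + 1) = 1 ∧
      IsGroundStateInSector
        (hubbardTorus 2 (m + 1) 1 U + ((-(g / ((m + 1 : ℕ) : ℝ) ^ 2) : ℝ) : ℂ) •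
          ((pairField dWaveFormFactor (m + 1))ᴴ * pairField dWaveFormFactor (m + 1)))
        (2 * ⌊(1 - δ) * ((m + 1 : ℕ) : ℝ) ^ 2 / 2⌋₊) 0 (ψ (m + 1))) :
    HasLongRangeOrder (fun k => halfOpenBox 2 (2 * k))
      (fun k => torusPullback (pairFieldCorr dWaveFormFactor ψ) (2 * k)) := by
  have hδ0 : 0 < δ := hδ.1
  have hgd : 0 < g * (1 - δ) - 8 := by linarith
  have hg0 : 0 < g := by nlinarith [hδ.2]
  have hκ : 0 < δ * (g * (1 - δ) - 8) / 8 := by positivity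
  refine CrutchAxis.crutch_hasLongRangeOrder_of_trials U hg0 hκ
    (L₁ := max 4 ⌈4 * (g * δ + 8) / (δ * (g * (1 - δ) - 8))⌉₊)
    (fun m hm hL₁ => mottLimit_trial (L := m + 1) (le_trans (le_max_left _ _) hL₁) hm hδ hg hU
      ?_) ψ hψ
  have h1 : (⌈4 * (g * δ + 8) / (δ * (g * (1 - δ) - 8))⌉₊ : ℝ) ≤ ((m + 1 : ℕ) : ℝ) := by
    exact_mod_cast le_trans (le_max_right 4 _) hL₁
  have h2 : ((m + 1 : ℕ) : ℝ) ≤ ((m + 1 : ℕ) : ℝ) ^ 2 := by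
    have h3 : (1 : ℝ) ≤ ((m + 1 : ℕ) : ℝ) := by exact_mod_cast Nat.succ_pos m
    nlinarith
  exact le_trans (Nat.le_ceil _) (h1.trans h2)

/-- **Theorem 34″, threshold form.** For `δ ∈ (0, 1/2)` and every `g > 8/(1-δ)` there is a
repulsion threshold `U₁` (namely `16 + 512/(δ(g(1-δ) - 8))`) beyond which every normalised
ground-state family of `H_U - (g/L²) Δ_dᴴ Δ_d` in the summit's doped sectors has d-wave pair-field
long-range order. [this work] -/
theorem exists_threshold_crutch_hasLongRangeOrder {δ : ℝ} (hδ : δ ∈ Set.Ioo (0 : ℝ) (1 / 2))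
    {g : ℝ} (hg : 8 / (1 - δ) < g) :
    ∃ U₁ : ℝ, ∀ U : ℝ, U₁ ≤ U →
      ∀ ψ : ∀ L, Fock (Orb (FermionTorus 2 L)),
        (∀ m : ℕ, Even (m + 1) → star (ψ (m + 1)) ⬝ᵥ ψ (m + 1) = 1 ∧
          IsGroundStateInSector
            (hubbardTorus 2 (m + 1) 1 U + ((-(g / ((m + 1 : ℕ) : ℝ) ^ 2) : ℝ) : ℂ) •
              ((pairField dWaveFormFactor (m + 1))ᴴ * pairField dWaveFormFactor (m + 1)))
            (2 * ⌊(1 - δ) * ((m + 1 : ℕ) : ℝ) ^ 2 / 2⌋₊) 0 (ψ (m + 1))) →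
        HasLongRangeOrder (fun k => halfOpenBox 2 (2 * k))
          (fun k => torusPullback (pairFieldCorr dWaveFormFactor ψ) (2 * k)) := by
  have h1δ : 0 < 1 - δ := by linarith [hδ.2]
  have hg' : 8 < g * (1 - δ) := by
    have := (div_lt_iff₀ h1δ).1 hg; linarith
  exact ⟨16 + 512 / (δ * (g * (1 - δ) - 8)), fun U hU ψ hψ =>
    mottLimit_crutch_hasLongRangeOrder hδ hg' hU ψ hψ⟩

end Summit.HubbardSuperconductivity.HubbardSuperconductivity.Theorems.DimerMottLimit
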